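import Literature.AnabelianGeometry.AbsoluteAnabelian.AbsTopIII.CyclotomicSynchronization
import Literature.AnabelianGeometry.AbsoluteAnabelian.GaloisSectionsFacts
import HarnessLib

/-!
# The group-theoretic cyclotome `G ↦ μ_Ẑ(G)` instantiates the abstract "Galois cyclotome"

[AbsTopIII] Cor. 1.10 (i)(a) (manuscript p. 41–42, lit key `paper:url-5493eb38cbb7`) constructs
`μ_Ẑ(G) := Hom(ℚ/ℤ, lim_{→ H ⊆ G open} (H^ab)_tors)` "group-theoretically" from a profinite group `G`
(`muZhat`, files `GaloisCyclotome*.lean`).  The [GalSect] file of this directory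
(`GaloisSectionsFacts.lean`, [GalSect] §4 p. 17 "`μ^∧_{ℚ/ℤ}(K̄)` recovered group-theoretically")
records the consumer-side interface as an ABSTRACT output structure `GalSect.GaloisCyclotome`
(`μ : ProfiniteGrp → Type`, transport `map` along `≃ₜ*`, `map_refl`, `map_trans`).  This file
provides the REAL instance of that structure: `GalSect.GaloisCyclotome.ofVerlagerung`, with
`μ G := muZhat G` and `map e := muZhat.congr e` — so every statement typed over an abstract
`T : GalSect.GaloisCyclotome` (e.g. `GalSect.Thm_4_3`, cuspidal synchronizations) can be
specialised to the group-theoretic cyclotome of [AbsTopIII] Cor. 1.10 — and derives, from the two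
typed synchronization facts of `CyclotomicSynchronization.lean` ([AbsTopIII] Thm. 1.9 (b):
`I_z ⥲ M_X`, Cor. 1.10 (ii)(c): `μ_Ẑ(G_k) ⥲ M_X`), the existence of a [GalSect]-style cuspidal
synchronization `μ_Ẑ(G_k) ⥲ I_z` for the real cyclotome (`CurveModel.nonempty_cuspidalSynchronization`).
HONEST FRAMING: a definitional bridge plus one derivation from named facts; nothing here asserts
those facts.
-/

noncomputable section

universe u

namespace Literature.AnabelianGeometry.AbsoluteAnabelian

/-- `muZhat.congr` along the identity is the identity.
[cite: MochizukiAbsTopIII2015, Cor 1.10 (i) p.42] -/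
theorem muZhat.congr_refl (G : ProfiniteGrp.{u}) :
    muZhat.congr (ContinuousMulEquiv.refl G) = MulEquiv.refl (muZhat G) :=
  MulEquiv.ext fun ζ => Subtype.ext (funext fun n => by simp [muQZ.map_refl])

/-- `muZhat.congr` is compatible with composition.
[cite: MochizukiAbsTopIII2015, Cor 1.10 (i) p.42] -/
theorem muZhat.congr_trans {G H K : ProfiniteGrp.{u}} (e : G ≃ₜ* H) (f : H ≃ₜ* K) :
    muZhat.congr (e.trans f) = (muZhat.congr e).trans (muZhat.congr f) :=
  MulEquiv.ext fun ζ => Subtype.ext (funext fun n => by simp [muQZ.map_trans])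

/-- **The group-theoretic cyclotome as a `GalSect.GaloisCyclotome`**: `G ↦ μ_Ẑ(G)`
([AbsTopIII] Cor. 1.10 (i)(a): `Hom(ℚ/ℤ, lim_{→ H} (H^ab)_tors)` along the Verlagerung) with its
transport along bicontinuous isomorphisms — the REAL instance of the abstract output structure of
`GaloisSectionsFacts.lean` ([GalSect] §4 p. 17). [cite: MochizukiAbsTopIII2015, Cor 1.10 (i) p.41] -/
def GalSect.GaloisCyclotome.ofVerlagerung : GalSect.GaloisCyclotome.{u} where
  μ G := muZhat G
  map e := muZhat.congr e
  map_refl G := muZhat.congr_refl G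
  map_trans e f := muZhat.congr_trans e f

/-- The underlying type of the instance at `G` is `μ_Ẑ(G)`.
[cite: MochizukiAbsTopIII2015, Cor 1.10 (i) p.41] -/
theorem GalSect.GaloisCyclotome.ofVerlagerung_μ (G : ProfiniteGrp.{u}) :
    GalSect.GaloisCyclotome.ofVerlagerung.μ G = muZhat G :=
  rfl

namespace AbsTopIII.CurveModel

/-- **Cuspidal synchronization for the real cyclotome, from Thm. 1.9 (b) and Cor. 1.10 (ii)(c)**:
if the model satisfies the two typed synchronization facts, then for a cusp `z` (free procyclic
inertia) of a cofinite open `U ⊆ X` with all cusps rational over an MLF, `X` proper scheme-like of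
genus `≥ 2`,
there is an isomorphism `μ_Ẑ(G_k) ⥲ I_z` — a `GalSect.CuspidalSynchronization` for the instance
`ofVerlagerung` (composite `μ_Ẑ(G_k) ⥲ M_X ⥲ I_z`).  PROVED from the named facts.
[cite: MochizukiAbsTopIII2015, Cor 1.10 (ii) p.42] -/
theorem nonempty_cuspidalSynchronization (M : CurveModel.{u}) (h9 : M.Thm_1_9_b)
    (h10 : M.Cor_1_10_ii_c) {U X : M.Curve} (h : M.IsCofiniteOpen U X) (hU : M.IsScheme U)
    (hX : M.IsScheme X) (hP : M.IsProper X) (hg : 2 ≤ M.genus X) (hk : IsMLF (M.base U))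
    (hrat : ∀ c : (M.cusps U).Cusp, (M.cusps U).IsRational c) (z : (M.cusps U).Cusp)
    (hI : FundamentalExtension.IsFreeProcyclic ((M.cusps U).Icusp z)) :
    Nonempty (GalSect.CuspidalSynchronization GalSect.GaloisCyclotome.ofVerlagerung (M.ext U)
      (M.cusps U) z) := by
  obtain ⟨φ₁, -⟩ := h9 U X h hU hX hP hg hrat z hI
  obtain ⟨φ₂, -⟩ := h10 U X h hU hX hP hg hk
  let ψ : Additive (muZhat (M.ext U).gal) ≃+ Additive ((M.cusps U).Icusp z) := φ₂.trans φ₁.symm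
  exact ⟨⟨MulEquiv.toAdditive.symm ψ⟩⟩

end AbsTopIII.CurveModel

end Literature.AnabelianGeometry.AbsoluteAnabelian
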